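import Summits.BirchSwinnertonDyer.BirchSwinnertonDyer.Theorems.PrintCf2RubinValueTwoRowTwoKernelResCor
import Literature.NumberTheory.EllipticCurves.Kato2004.IwasawaH1TorsionFreeProofs
import HarnessLib

/-!
# M-LINE-PIN / (α3) ROW 2, FILE 7b: `cor ∘ res = [F′:F]` on ty2's level groups — every class of `H¹(G_S(F), μ_{p^k} ⊗ θ)` times `[F′:F]`
# is a corestriction from `F′`

Cell `bsd-print-cf2`, WIDTH seat `bsd-line-cf2-p1-w6` g9 (prover-bsd-line-cf2-p1-w6-g9-0), (α3) ROW 2 of the JLK road on the DECIDING child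
stmt-BirchSwinnertonDyer-24721 `PrintCf2RubinValueTwo.MainConjClauseAtSplitTwoQuadDA` (memo `HOME/bsd-line-cf2-p1-w6/ROW2-RHO3-SPEC-w6g9.md` §2 (C-d):
the cokernel half of ρ3); `--supports` that item (helper, Theses-free). HONEST FRAMING: transport of the tree's `coresLe_resLe` (Serre I §2.4 Prop. 9)
into ty2's currency; nothing here closes the crux or a registered stub; no summit statement is proved by this seat; BSD is not proved by any of this.
THEOREMS ONLY (no definition, no named fact, no instance, no `sorry`).

* `relCores_resLe_eq_index_smul` — `cor_{U′→U} (res_{U′} y) = [U : U′] • y` on `H¹(G_S(F), μ_{p^k} ⊗ θ)`, `U′ ≤ U` open, `N_S ≤ U′`;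
* **`exists_relCores_eq_index_smul`** — hence `[U:U′] • y` is in the image of `cor_{U′→U}` for EVERY `y`: with `U′ = Gal(K̄/F_n)`, `U = Gal(K̄/K̃_n)`
  the cokernel of `cor_{F_n→K̃_n}` is killed by `[F_n : K̃_n] ∣ [K₀ : K]` ((C-d) of the cokernel half; `2` on the crux).

presearch: Serre, *Galois Cohomology* I §2.4 Prop. 9 (cor ∘ res = index) — tree `coresLe_resLe`. beyond-print theorem: no.

References: J.-P. Serre, *Galois Cohomology* (1997) I §2.4 Prop. 9; J. Neukirch, A. Schmidt, K. Wingberg, *Cohomology of Number Fields* I §5 (1.5.7).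
-/

noncomputable section

open scoped Classical

-- the summit namespace `Summit.BirchSwinnertonDyer.BirchSwinnertonDyer` repeats the problem name by design (D-0017)
set_option linter.dupNamespace false
set_option autoImplicit false

open scoped NumberField
open Field IsDedekindDomain
open Literature.NumberTheory.GaloisRepresentations Literature.NumberTheory.GaloisRepresentations.DiscreteGaloisModule
open Literature.NumberTheory.ComplexMultiplication.EllipticUnits.JohnsonLeungKings2011

namespace Summit.BirchSwinnertonDyer.BirchSwinnertonDyer.Theorems.PrintCf2.RowTwo

variable {K : Type} [Field K] [NumberField K] (p : ℕ) [Fact p.Prime] (S : Set (HeightOneSpectrum (𝓞 K)))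
  (θ : absoluteGaloisGroup K →ₜ* ℤ_[p]ˣ) (k : ℕ) {U U' : Subgroup (absoluteGaloisGroup K)}

/-- **`cor_{U′→U} ∘ res_{U′} = [U : U′]`** on `H¹(G_S(F), μ_{p^k} ⊗ θ)` (`U′ ≤ U` open, `N_S ≤ U′`; the index read as `[U_S : U′_S] = [U : U′]` through
g8's `exists_quotientEquiv_imGS`). [cite: SerreGaloisCohomology1997, I §2.4 Prop. 9] -/
theorem relCores_resLe_eq_index_smul (h : U' ≤ U) (hU : IsOpen (U : Set (absoluteGaloisGroup K)))
    (hU' : IsOpen (U' : Set (absoluteGaloisGroup K))) (hN : ramificationSubgroup K S ≤ U') [Fintype (U ⧸ U'.subgroupOf U)]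
    (y : levelCoh p S θ U k 1) :
    relCores p S θ h hU hU' k 1 (resLe (coeffGS p S θ k).toTopRep (imGS_le_of_le S h) 1 y) = (Fintype.card (U ⧸ U'.subgroupOf U)) • y := by
  classical
  haveI : TotallyDisconnectedSpace (GaloisGroupUnramifiedOutside K S) :=
    Literature.GroupTheory.ProfiniteSubquotients.totallyDisconnectedSpace_quotient
      (ramificationSubgroup K S) (ramificationSubgroup_isClosed K S)
  haveI : CompactSpace (imGS S U) := isCompact_iff_compactSpace.mp (isClosed_imGS' S hU).isCompact
  haveI : ((imGS S U').subgroupOf (imGS S U)).FiniteIndex := by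
    haveI := finiteIndex_imGS' S hU'
    infer_instance
  obtain ⟨e, -⟩ := exists_quotientEquiv_imGS S (U := U) hN
  letI : Fintype (↥(imGS S U) ⧸ (imGS S U').subgroupOf (imGS S U)) := Fintype.ofEquiv _ e
  rw [relCores_one_eq_coresLe p S θ h hU hU' k, coresLe_resLe, Subgroup.index_eq_card, Nat.card_eq_fintype_card,
    ← Fintype.card_congr e, Nat.cast_smul_eq_nsmul]
  rfl

/-- **Every `[U:U′] • y` is a corestriction from `U′`** (`y ∈ H¹(G_S(F), μ_{p^k} ⊗ θ)`). [cite: SerreGaloisCohomology1997, I §2.4 Prop. 9] -/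
theorem exists_relCores_eq_index_smul (h : U' ≤ U) (hU : IsOpen (U : Set (absoluteGaloisGroup K)))
    (hU' : IsOpen (U' : Set (absoluteGaloisGroup K))) (hN : ramificationSubgroup K S ≤ U') [Fintype (U ⧸ U'.subgroupOf U)]
    (y : levelCoh p S θ U k 1) :
    ∃ c : levelCoh p S θ U' k 1, relCores p S θ h hU hU' k 1 c = (Fintype.card (U ⧸ U'.subgroupOf U)) • y :=
  ⟨_, relCores_resLe_eq_index_smul p S θ k h hU hU' hN y⟩

end Summit.BirchSwinnertonDyer.BirchSwinnertonDyer.Theorems.PrintCf2.RowTwo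

end
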